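import Summits.QuantumFields.BalabanUV.Beta.GAN24.ContactOneGaugeCellMaxwell
import Summits.QuantumFields.BalabanUV.Beta.GAN24.WardPairingCoarse
import Summits.QuantumFields.BalabanUV.Beta.WardLocusRecursive
import Summits.QuantumFields.BalabanUV.Beta.GAN24.ResolventLegCharges

/-!
# `BalabanUV.Beta.GAN24.LambdaSectorClassSlotZero` — binder row G-an2-4 ∕ (CONV-C), W-slot CT-W, conservation law (C)∕(C)sym, letter (Λ₀) of this lineage's note
# `HOME/b2b-balaban-gan24-formalise-leaf-04/g68/EXIT-FACE-CURRENT-TOWER.md` §7: **THE LEVEL-`0` Λ SECTOR OF THE ROOTED NATIVE SPINE `S0NAt` CARRIES NO CLASS-SLOT CURRENT** — for the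
# slot datum `s(u) = c + (Φ(u_ν+1) − Φ(u_ν))` the slot contraction of an3's Wilson-Hessian columns `Σ'_u s(u)·elCol ν u α w` is `(d*d dφ)_α(w) = 0` (`φ(x) = c·x_ν + Φ(x_ν)`; matrix
# symmetry of `d*d`, the Maxwell contraction, `d∘d = 0`), hence `Σ'_u s(u)·lamCoeffOf A Lc μ Y ν u = 0` for every decaying `A` and `Σ'_u s(u)·S^Λ_0 ν u v q (inl κ′)(inl β) = 0`,
# `S^Λ_0 = SLam Lc (lamCoeffOf (KInv Lc) Lc) hessFFAt` — the level-`0` twin of `LambdaSectorClassSlot`.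

NOT IN PRINT; OUR BOOKKEEPING ([folklore] `tsum`∕Fubini bookkeeping BY NAME over leaf-02's `ContactOneGaugeCellMaxwell.tsum_mul_curvAdj_curv_delta1` (the Maxwell contraction), an5∕road-p1's
`BorderedHessianSymmetry.curvAdj_curv_delta1_symm`, `WardPairingCoarse.curvAdj_curv_dz`, node 5's `BalabanStepJets.lamCoeffOf ∕ elCol ∕ elCol_eq_zero_of_not_mem_box1 ∕ abs_elCol_le ∕
abs_lamCoeffOf_le`, node 7a's `InterLevelTransport.SLam ∕ cwsum_apply`, an1's `biLoc_hessFFAt`; G-an2-4 formalisation swarm, leaf prover `b2b-balaban-gan24-formalise-leaf-04`, gen 68).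
HONEST FRAMING (cell contract, verbatim): «discharging `BetaPertH` makes Bałaban's UV stability UNCONDITIONAL — a real constructive-QFT result; it is NOT the continuum limit and NOT the Clay
problem.»  HONEST DEPENDENCY (verbatim): «continuum YM on T⁴ ⇐ BetaPertH ∧ nine spine estimates (0/9 proved); BetaPertH ⇐ (D1) ∧ (D4) ∧ CAP+tail; G-an2-4 gates asym, D1 and NE2/3/4.»

WHAT ([folklore]; generic `d`, `[NeZero Lc]`, in-block root, bounded `Φ : ℤ → ℝ`; 0 `def`, 0 cited facts, 0 `def … : Prop`, 0 sorry): §1 `bondDelta_eq_delta1` (rfl), `classForm_eq_dz`,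
**`tsum_classSlot_elCol_eq_zero`** (`Σ'_u (c + dΦ(u_ν))·elCol ν u α w = 0`); §2 **`tsum_classSlot_lamCoeffOf_eq_zero`** (every decaying `A`); §3 **`tsum_classSlot_lamSectorZero_eq_zero`**,
**`divFree_lamSectorZero_current`** (the Λ hypothesis of `ExitFaceCurrentSectorSplit.divFree_current_S0NAt_of_sectors` for class slot data, any leg weight).  Asserts NO value of Bałaban's
tables; discharges NOTHING of (C)sym ∕ (Q-D) ∕ (Q-D-rate) ∕ «T2Shape» ∕ «T2Drift» ∕ (hW, hWall); NEVER «G-an2-4 closed» as (CONV-C); NOT D1, NOT `BetaPertH`, NOT continuum, NOT Clay.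
2026-08-23; no existing file touched.
-/

noncomputable section

open Finset
open scoped BigOperators
open Literature.MathematicalPhysics.QuantumFieldTheory
open Literature.MathematicalPhysics.QuantumFieldTheory.Balaban1983to89
open Literature.MathematicalPhysics.QuantumFieldTheory.Balaban1983to89.Beta
open B12Sec2to5 (l1 l1_nonneg)
open ExpKernelCalculus (Site MKer Decays BiLoc Zl Zl_nonneg summable_exp_shift' tsum_exp_shift' l1_sub_symm)
open OneStepResolventKernel (Fib KInv decays_KInv decays_mono)
open AffineAveraging (Form1 box toSite curv curvAdj dz)
open AveragingHessianKernels (ell)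
open AveragingHessianKernelsRooted (hessFFAt biLoc_hessFFAt)
open InterLevelTransport (SLam cwsum_apply)
open BalabanStepJets (lamCoeffOf elCol bondDelta box1 mem_box1 elCol_eq_zero_of_not_mem_box1 abs_elCol_le abs_lamCoeffOf_le)
open KKTFluctuationKernel (delta1)
open Summit.QuantumFields.BalabanUV.Beta.BorderedHessian (curvAdj_curv_delta1_symm)
open Summit.QuantumFields.BalabanUV.Beta.GAN24.ContactOneGaugeCellMaxwell (tsum_mul_curvAdj_curv_delta1)
open Summit.QuantumFields.BalabanUV.Beta.GAN24.WardPairingCoarse (curvAdj_curv_dz)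
open Summit.QuantumFields.BalabanUV.Beta.GAN24.ResolventLegCharges (summable_exp_coarse')

namespace Summit.QuantumFields.BalabanUV.Beta.GAN24.LambdaSectorClassSlotZero

variable {d : ℕ} {Lc : ℕ} [NeZero Lc] {r : Fin (d + 1) → ℕ}

/-! ## §1 The Wilson-Hessian columns kill class slot data -/

omit [NeZero Lc] in
/-- [folklore] Node 5's elementary 1-form IS the `KKTFluctuationKernel` delta 1-form. -/
theorem bondDelta_eq_delta1 (κ : Fin (d + 1)) (u : Site (d + 1)) : bondDelta κ u = delta1 κ u := rfl

omit [NeZero Lc] in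
/-- [folklore] The class slot datum on the `ν`-bonds is the exact 1-form `dφ`, `φ(x) = c·x_ν + Φ(x_ν)`. -/
theorem classForm_eq_dz (c : ℝ) (Φ : ℤ → ℝ) (ν : Fin (d + 1)) :
    (fun (β : Fin (d + 1)) (z : Site (d + 1)) => if β = ν then c + (Φ (z ν + 1) - Φ (z ν)) else 0) =
      dz (fun x : Site (d + 1) => c * (x ν : ℝ) + Φ (x ν)) := by
  funext β z
  simp only [dz]
  by_cases hβ : β = ν
  · subst hβ
    simp only [if_true, Pi.add_apply, AffineAveraging.unitVec_apply]
    push_cast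
    ring
  · have e : (z + AffineAveraging.unitVec β) ν = z ν := by
      simp only [Pi.add_apply, AffineAveraging.unitVec_apply, if_neg (Ne.symm hβ), add_zero]
    rw [if_neg hβ, e]
    ring

omit [NeZero Lc] in
/-- [folklore] **an3's WILSON-HESSIAN COLUMNS KILL CLASS SLOT DATA**: `Σ'_u (c + (Φ(u_ν+1) − Φ(u_ν)))·elCol ν u α w = (d*d dφ)_α(w) = 0`. -/
theorem tsum_classSlot_elCol_eq_zero (ν α : Fin (d + 1)) (w : Site (d + 1)) (c : ℝ) (Φ : ℤ → ℝ) :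
    ∑' u : Site (d + 1), (c + (Φ (u ν + 1) - Φ (u ν))) * elCol ν u α w = 0 := by
  -- matrix symmetry of `d*d`: read the column at `(α, w)` instead
  have e : ∀ u : Site (d + 1), (c + (Φ (u ν + 1) - Φ (u ν))) * elCol ν u α w =
      ∑ β : Fin (d + 1), (fun (β : Fin (d + 1)) (z : Site (d + 1)) => if β = ν then c + (Φ (z ν + 1) - Φ (z ν)) else 0) β u * curvAdj (curv (delta1 α w)) β u := by
    intro u
    simp only [ite_mul, zero_mul, Finset.sum_ite_eq', Finset.mem_univ, if_true]
    rw [elCol, bondDelta_eq_delta1, curvAdj_curv_delta1_symm]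
  rw [tsum_congr e, tsum_mul_curvAdj_curv_delta1, classForm_eq_dz, curvAdj_curv_dz]
  rfl

/-! ## §2 The slot contraction of the level-`0` conversion coefficients vanishes -/

omit [NeZero Lc] in
/-- [folklore] **THE SLOT CONTRACTION OF `lamCoeffOf A N` WITH CLASS DATA VANISHES** (every decaying `A`, every `N μ Y`):
`Σ'_u (c + dΦ(u_ν))·lamCoeffOf A N μ Y ν u = 0` — per `(v, α)` shift `u ↦ u + v`, resum the finite support of the column, §1. -/
theorem tsum_classSlot_lamCoeffOf_eq_zero {A : MKer (d + 1) (Fib d)} {C δ : ℝ} (hA : Decays A C δ) (hδ : 0 < δ) (N : ℕ) (μ ν : Fin (d + 1)) (Y : Site (d + 1))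
    (c : ℝ) (Φ : ℤ → ℝ) {B : ℝ} (hΦ : ∀ s, |Φ s| ≤ B) :
    ∑' u : Site (d + 1), (c + (Φ (u ν + 1) - Φ (u ν))) * lamCoeffOf A N μ Y ν u = 0 := by
  classical
  have hC : 0 ≤ C := hA.nonneg (Sum.inl 0)
  have hs : ∀ u : Site (d + 1), |c + (Φ (u ν + 1) - Φ (u ν))| ≤ |c| + (B + B) := fun u =>
    (abs_add_le _ _).trans (add_le_add le_rfl ((abs_sub _ _).trans (add_le_add (hΦ _) (hΦ _))))
  have hBs : 0 ≤ |c| + (B + B) := (abs_nonneg _).trans (hs 0)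
  -- summability of each `(v, α)` term in `u`
  have hsum : ∀ (v : Site (d + 1)) (α : Fin (d + 1)), Summable fun u : Site (d + 1) =>
      (c + (Φ (u ν + 1) - Φ (u ν))) * (A ((N : ℤ) • Y) (u + v) (Sum.inr μ) (Sum.inl α) * elCol ν u α (u + v)) := by
    intro v α
    have hm : Summable fun u : Site (d + 1) => (|c| + (B + B)) * (C * Real.exp (-δ * l1 ((N : ℤ) • Y - (u + v))) * (16 * ((d + 1 : ℕ) : ℝ))) := by
      have h := (summable_exp_shift' hδ ((N : ℤ) • Y - v)).congr (fun u => by rw [l1_sub_symm, show (N : ℤ) • Y - v - u = (N : ℤ) • Y - (u + v) by abel])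
      exact ((h.mul_left C).mul_right _).mul_left _
    refine Summable.of_norm_bounded hm (fun u => ?_)
    rw [Real.norm_eq_abs, abs_mul, abs_mul]
    exact mul_le_mul (hs u) (mul_le_mul (hA _ _ _ _) (abs_elCol_le ν u α (u + v)) (abs_nonneg _) (by positivity)) (by positivity) hBs
  -- unfold and move the finite `(v, α)` sums out
  have e1 : ∀ u : Site (d + 1), (c + (Φ (u ν + 1) - Φ (u ν))) * lamCoeffOf A N μ Y ν u =
      ∑ v ∈ box1 (d + 1), ∑ α : Fin (d + 1), (c + (Φ (u ν + 1) - Φ (u ν))) * (A ((N : ℤ) • Y) (u + v) (Sum.inr μ) (Sum.inl α) * elCol ν u α (u + v)) := by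
    intro u
    simp only [lamCoeffOf, Finset.mul_sum]
  rw [tsum_congr e1, Summable.tsum_finsetSum (fun v _ => summable_sum fun α _ => hsum v α)]
  simp only [Summable.tsum_finsetSum (fun α _ => hsum _ α)]
  -- shift `u ↦ w − v` in each term and swap the finite `v`-sum back inside
  have e2 : ∀ (v : Site (d + 1)) (α : Fin (d + 1)),
      ∑' u : Site (d + 1), (c + (Φ (u ν + 1) - Φ (u ν))) * (A ((N : ℤ) • Y) (u + v) (Sum.inr μ) (Sum.inl α) * elCol ν u α (u + v)) =
      ∑' w : Site (d + 1), A ((N : ℤ) • Y) w (Sum.inr μ) (Sum.inl α) * ((c + (Φ ((w - v) ν + 1) - Φ ((w - v) ν))) * elCol ν (w - v) α w) := by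
    intro v α
    rw [← (Equiv.subRight v).tsum_eq (fun u : Site (d + 1) => (c + (Φ (u ν + 1) - Φ (u ν))) * (A ((N : ℤ) • Y) (u + v) (Sum.inr μ) (Sum.inl α) * elCol ν u α (u + v)))]
    refine tsum_congr fun w => ?_
    simp only [Equiv.subRight_apply, sub_add_cancel]
    ring
  simp only [e2]
  have hsum' : ∀ (v : Site (d + 1)) (α : Fin (d + 1)), Summable fun w : Site (d + 1) =>
      A ((N : ℤ) • Y) w (Sum.inr μ) (Sum.inl α) * ((c + (Φ ((w - v) ν + 1) - Φ ((w - v) ν))) * elCol ν (w - v) α w) := by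
    intro v α
    have h := (Equiv.subRight v).summable_iff.2 (hsum v α)
    refine h.congr fun w => ?_
    simp only [Function.comp, Equiv.subRight_apply, sub_add_cancel]
    ring
  rw [Finset.sum_comm]
  refine Finset.sum_eq_zero fun α _ => ?_
  rw [← Summable.tsum_finsetSum (fun v _ => hsum' v α)]
  simp only [← Finset.mul_sum]
  -- the finite `v`-sum IS the full slot contraction (support of the column), which vanishes by §1
  have e3 : ∀ w : Site (d + 1), ∑ v ∈ box1 (d + 1), (c + (Φ ((w - v) ν + 1) - Φ ((w - v) ν))) * elCol ν (w - v) α w =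
      ∑' u : Site (d + 1), (c + (Φ (u ν + 1) - Φ (u ν))) * elCol ν u α w := by
    intro w
    symm
    have hinj : Set.InjOn (fun v : Site (d + 1) => w - v) (box1 (d + 1) : Set (Site (d + 1))) := fun v _ v' _ h => by simpa using h
    rw [tsum_eq_sum (s := (box1 (d + 1)).image (fun v => w - v)) (fun u hu => ?_), Finset.sum_image hinj]
    -- off the image the column vanishes
    have hv : w - u ∉ box1 (d + 1) := fun h => hu (Finset.mem_image.2 ⟨w - u, h, by abel⟩)
    have h0 := elCol_eq_zero_of_not_mem_box1 (κ' := ν) (u := u) (α := α) hv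
    rw [show u + (w - u) = w by abel] at h0
    rw [h0, mul_zero]
  simp only [e3, tsum_classSlot_elCol_eq_zero ν α _ c Φ, mul_zero, tsum_zero]

/-! ## §3 The level-`0` Λ sector carries no class-slot current -/

/-- [folklore] **THE LEVEL-`0` Λ SECTOR CARRIES NO CLASS-SLOT CURRENT**: `Σ'_u (c + (Φ(u_ν+1) − Φ(u_ν)))·S^Λ_0 ν u v q (inl κ′)(inl β) = 0`,
`S^Λ_0 = SLam Lc (lamCoeffOf (KInv Lc) Lc) hessFFAt`. -/
theorem tsum_classSlot_lamSectorZero_eq_zero (hr : r ∈ box (d + 1) Lc) (ν β κ' : Fin (d + 1)) (c : ℝ) (Φ : ℤ → ℝ) {B : ℝ} (hΦ : ∀ s, |Φ s| ≤ B)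
    (v q : Site (d + 1)) :
    ∑' u : Site (d + 1), (c + (Φ (u ν + 1) - Φ (u ν))) *
        SLam Lc (lamCoeffOf (KInv (N := Lc) (d := d)) Lc) (fun μ y => hessFFAt (toSite r) Lc μ y) ν u v q (Sum.inl κ') (Sum.inl β) = 0 := by
  classical
  have hLc : 1 ≤ Lc := Nat.one_le_iff_ne_zero.mpr (NeZero.ne Lc)
  obtain ⟨δ₀, C, hδ₀, hC, hdec⟩ := decays_KInv (N := Lc) (d := d)
  have hc := abs_lamCoeffOf_le (N := Lc) hdec hC hδ₀.le
  set CL : ℝ := (3 : ℝ) ^ (d + 1) * ((d + 1 : ℕ) : ℝ) * (16 * ((d + 1 : ℕ) : ℝ)) * C * Real.exp (((d + 1 : ℕ) : ℝ) * δ₀) with hCL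
  have hCL0 : 0 ≤ CL := by positivity
  set CH : ℝ := 2 * (ell (d + 1) Lc : ℝ) ^ 2 * Real.exp (4 * ((d : ℝ) + 1) * Lc * δ₀) with hCH
  have hH : ∀ μ Y, BiLoc (hessFFAt (toSite r) Lc μ Y) ((Lc : ℤ) • Y) ((Lc : ℤ) • Y) CH δ₀ := fun μ Y => biLoc_hessFFAt hLc μ Y hr hδ₀.le
  have hCH0 : 0 ≤ CH := (hH 0 0).nonneg (Sum.inl 0)
  have hs : ∀ u : Site (d + 1), |c + (Φ (u ν + 1) - Φ (u ν))| ≤ |c| + (B + B) := fun u =>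
    (abs_add_le _ _).trans (add_le_add le_rfl ((abs_sub _ _).trans (add_le_add (hΦ _) (hΦ _))))
  have hBs : 0 ≤ |c| + (B + B) := (abs_nonneg _).trans (hs 0)
  have ept : ∀ u : Site (d + 1), SLam Lc (lamCoeffOf (KInv (N := Lc) (d := d)) Lc) (fun μ y => hessFFAt (toSite r) Lc μ y) ν u v q (Sum.inl κ') (Sum.inl β) =
      -∑ μ : Fin (d + 1), ∑' Y : Site (d + 1), lamCoeffOf (KInv (N := Lc) (d := d)) Lc μ Y ν u * hessFFAt (toSite r) Lc μ Y v q (Sum.inl κ') (Sum.inl β) := by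
    intro u
    simp only [SLam, cwsum_apply]
  have hpair : ∀ μ : Fin (d + 1), Summable fun uY : Site (d + 1) × Site (d + 1) => (c + (Φ (uY.1 ν + 1) - Φ (uY.1 ν))) *
      (lamCoeffOf (KInv (N := Lc) (d := d)) Lc μ uY.2 ν uY.1 * hessFFAt (toSite r) Lc μ uY.2 v q (Sum.inl κ') (Sum.inl β)) := by
    intro μ
    have hMs : Summable fun uY : Site (d + 1) × Site (d + 1) => (|c| + (B + B)) * (CL * CH) *
        (Real.exp (-δ₀ * l1 ((Lc : ℤ) • uY.2 - uY.1)) * Real.exp (-δ₀ * l1 (v - (Lc : ℤ) • uY.2))) := by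
      refine Summable.mul_left _ ?_
      have hs' : Summable fun Yu : Site (d + 1) × Site (d + 1) => Real.exp (-δ₀ * l1 ((Lc : ℤ) • Yu.1 - Yu.2)) * Real.exp (-δ₀ * l1 (v - (Lc : ℤ) • Yu.1)) := by
        refine (summable_prod_of_nonneg (fun _ => mul_nonneg (Real.exp_pos _).le (Real.exp_pos _).le)).2 ⟨fun Y => ?_, ?_⟩
        · have h := (summable_exp_shift' hδ₀ ((Lc : ℤ) • Y)).mul_right (Real.exp (-δ₀ * l1 (v - (Lc : ℤ) • Y)))
          exact h.congr fun u => by rw [l1_sub_symm u ((Lc : ℤ) • Y)]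
        · have hb : ∀ Y : Site (d + 1), ∑' u : Site (d + 1), Real.exp (-δ₀ * l1 ((Lc : ℤ) • Y - u)) * Real.exp (-δ₀ * l1 (v - (Lc : ℤ) • Y)) =
              Zl (d + 1) δ₀ * Real.exp (-δ₀ * l1 (v - (Lc : ℤ) • Y)) := by
            intro Y
            rw [tsum_mul_right]
            congr 1
            rw [← tsum_exp_shift' (c := δ₀) ((Lc : ℤ) • Y)]
            exact tsum_congr fun u => by rw [l1_sub_symm ((Lc : ℤ) • Y) u]
          simp only [hb]
          exact (summable_exp_coarse' (d := d) hLc hδ₀ v).mul_left _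
      exact ((Equiv.prodComm (Site (d + 1)) (Site (d + 1))).summable_iff.2 hs').congr fun uY => by simp
    refine Summable.of_norm_bounded hMs (fun uY => ?_)
    rw [Real.norm_eq_abs, abs_mul, abs_mul]
    have h1 := hc μ uY.2 ν uY.1
    have h2 : |hessFFAt (toSite r) Lc μ uY.2 v q (Sum.inl κ') (Sum.inl β)| ≤ CH * Real.exp (-δ₀ * l1 (v - (Lc : ℤ) • uY.2)) := by
      refine (hH μ uY.2 v q _ _).trans (mul_le_mul_of_nonneg_left (Real.exp_le_exp.2 ?_) hCH0)
      nlinarith [l1_nonneg (v - (Lc : ℤ) • uY.2), l1_nonneg (q - (Lc : ℤ) • uY.2)]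
    calc |c + (Φ (uY.1 ν + 1) - Φ (uY.1 ν))| * (|lamCoeffOf (KInv (N := Lc) (d := d)) Lc μ uY.2 ν uY.1| *
          |hessFFAt (toSite r) Lc μ uY.2 v q (Sum.inl κ') (Sum.inl β)|)
        ≤ (|c| + (B + B)) * ((CL * Real.exp (-δ₀ * l1 ((Lc : ℤ) • uY.2 - uY.1))) * (CH * Real.exp (-δ₀ * l1 (v - (Lc : ℤ) • uY.2)))) :=
          mul_le_mul (hs _) (mul_le_mul h1 h2 (abs_nonneg _) (by positivity)) (by positivity) hBs
      _ = _ := by ring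
  have e : ∀ u : Site (d + 1), (c + (Φ (u ν + 1) - Φ (u ν))) *
      SLam Lc (lamCoeffOf (KInv (N := Lc) (d := d)) Lc) (fun μ y => hessFFAt (toSite r) Lc μ y) ν u v q (Sum.inl κ') (Sum.inl β) =
      -∑ μ : Fin (d + 1), (c + (Φ (u ν + 1) - Φ (u ν))) * ∑' Y : Site (d + 1),
        lamCoeffOf (KInv (N := Lc) (d := d)) Lc μ Y ν u * hessFFAt (toSite r) Lc μ Y v q (Sum.inl κ') (Sum.inl β) := by
    intro u; rw [ept u, mul_neg, Finset.mul_sum]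
  rw [tsum_congr e, tsum_neg, neg_eq_zero, Summable.tsum_finsetSum (fun μ _ => ((hpair μ).prod).congr fun u => by dsimp only; exact tsum_mul_left)]
  refine Finset.sum_eq_zero fun μ _ => ?_
  have hP := hpair μ
  have hP' : Summable fun Yu : Site (d + 1) × Site (d + 1) => (c + (Φ (Yu.2 ν + 1) - Φ (Yu.2 ν))) *
      (lamCoeffOf (KInv (N := Lc) (d := d)) Lc μ Yu.1 ν Yu.2 * hessFFAt (toSite r) Lc μ Yu.1 v q (Sum.inl κ') (Sum.inl β)) :=
    ((Equiv.prodComm (Site (d + 1)) (Site (d + 1))).summable_iff.2 hP).congr fun Yu => by simp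
  calc ∑' u : Site (d + 1), (c + (Φ (u ν + 1) - Φ (u ν))) * ∑' Y : Site (d + 1),
          lamCoeffOf (KInv (N := Lc) (d := d)) Lc μ Y ν u * hessFFAt (toSite r) Lc μ Y v q (Sum.inl κ') (Sum.inl β)
      = ∑' u : Site (d + 1), ∑' Y : Site (d + 1), (c + (Φ (u ν + 1) - Φ (u ν))) *
          (lamCoeffOf (KInv (N := Lc) (d := d)) Lc μ Y ν u * hessFFAt (toSite r) Lc μ Y v q (Sum.inl κ') (Sum.inl β)) :=
        tsum_congr fun u => (tsum_mul_left).symm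
    _ = ∑' uY : Site (d + 1) × Site (d + 1), (c + (Φ (uY.1 ν + 1) - Φ (uY.1 ν))) *
          (lamCoeffOf (KInv (N := Lc) (d := d)) Lc μ uY.2 ν uY.1 * hessFFAt (toSite r) Lc μ uY.2 v q (Sum.inl κ') (Sum.inl β)) := (hP.tsum_prod).symm
    _ = ∑' Yu : Site (d + 1) × Site (d + 1), (c + (Φ (Yu.2 ν + 1) - Φ (Yu.2 ν))) *
          (lamCoeffOf (KInv (N := Lc) (d := d)) Lc μ Yu.1 ν Yu.2 * hessFFAt (toSite r) Lc μ Yu.1 v q (Sum.inl κ') (Sum.inl β)) := by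
        rw [← (Equiv.prodComm (Site (d + 1)) (Site (d + 1))).tsum_eq (fun uY : Site (d + 1) × Site (d + 1) => (c + (Φ (uY.1 ν + 1) - Φ (uY.1 ν))) *
          (lamCoeffOf (KInv (N := Lc) (d := d)) Lc μ uY.2 ν uY.1 * hessFFAt (toSite r) Lc μ uY.2 v q (Sum.inl κ') (Sum.inl β)))]
        exact tsum_congr fun Yu => by simp [Equiv.prodComm_apply]
    _ = ∑' Y : Site (d + 1), ∑' u : Site (d + 1), (c + (Φ (u ν + 1) - Φ (u ν))) *
          (lamCoeffOf (KInv (N := Lc) (d := d)) Lc μ Y ν u * hessFFAt (toSite r) Lc μ Y v q (Sum.inl κ') (Sum.inl β)) := hP'.tsum_prod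
    _ = ∑' Y : Site (d + 1), (∑' u : Site (d + 1), (c + (Φ (u ν + 1) - Φ (u ν))) * lamCoeffOf (KInv (N := Lc) (d := d)) Lc μ Y ν u) *
          hessFFAt (toSite r) Lc μ Y v q (Sum.inl κ') (Sum.inl β) := by
        refine tsum_congr fun Y => ?_
        rw [← tsum_mul_right]
        exact tsum_congr fun u => by ring
    _ = 0 := by simp only [tsum_classSlot_lamCoeffOf_eq_zero hdec hδ₀ Lc μ ν _ c Φ hΦ, zero_mul, tsum_zero]

/-- [folklore] **COROLLARY — THE LEVEL-`0` Λ HYPOTHESIS OF THE SECTOR SPLIT HOLDS FOR CLASS SLOT DATA** (any leg weight `h`, any `v`). -/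
theorem divFree_lamSectorZero_current (hr : r ∈ box (d + 1) Lc) (ν β : Fin (d + 1)) (c : ℝ) (Φ : ℤ → ℝ) {B : ℝ} (hΦ : ∀ s, |Φ s| ≤ B)
    (h : Site (d + 1) → ℝ) (v : Site (d + 1)) :
    ∑ κ' : Fin (d + 1),
      ((∑' q : Site (d + 1), h q * ∑' u : Site (d + 1), (c + (Φ (u ν + 1) - Φ (u ν))) *
          SLam Lc (lamCoeffOf (KInv (N := Lc) (d := d)) Lc) (fun μ y => hessFFAt (toSite r) Lc μ y) ν u v q (Sum.inl κ') (Sum.inl β))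
        - ∑' q : Site (d + 1), h q * ∑' u : Site (d + 1), (c + (Φ (u ν + 1) - Φ (u ν))) *
          SLam Lc (lamCoeffOf (KInv (N := Lc) (d := d)) Lc) (fun μ y => hessFFAt (toSite r) Lc μ y) ν u (v - B6BondElimination.unitVec κ') q (Sum.inl κ') (Sum.inl β)) = 0 := by
  simp only [tsum_classSlot_lamSectorZero_eq_zero hr ν β _ c Φ hΦ, mul_zero, tsum_zero, sub_self, Finset.sum_const_zero]

end Summit.QuantumFields.BalabanUV.Beta.GAN24.LambdaSectorClassSlotZero
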